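import Literature.NumberTheory.LFunctions.SchoenfeldZeroSums
import Literature.NumberTheory.LFunctions.ZetaArgBacklundExplicit
import Literature.NumberTheory.LFunctions.ZetaZerosProofs
import Literature.NumberTheory.DiophantineGeometry.NamedHypothesesProofs
import HarnessLib

/-!
# Route LittlewoodRadar · crux `PintzLocalisationPos` (stmt-RiemannHypothesis-23714) · LINE `pintz-kernel` · stub `stub_localcount`

The registered stub `stub_localcount` of the skeleton `Lines/pintz-kernel.lean` (route lead
rlead-rh-LittlewoodRadar g0): **the zeros of `ζ` within height `5` of a given height `T > 14` have total
multiplicity `≤ 100 (1 + log (T + 5))`.**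

Proof: such zeros lie in the counting window `zerosBetween (T-5) (T+5)` (they are in the open strip by
`re_pos_of_riemannZeta_eq_zero` / `re_lt_one_of_riemannZeta_eq_zero`), so the sum is at most
`N(T+5) − N(T−5)` (`zetaZeroCount_sub_eq_sum`).  For `T ≥ 35` both heights are `≥ 30` and the tree's
explicit Riemann–von Mangoldt bound `|N(t) − (t/2π) log(t/2πe)| ≤ 0.3083 log t + 4.128`
(`abs_zetaZeroCount_sub_main_le_explicit`) together with the elementary
`a log a − b log b ≤ 10 log a + 10` (`a = T+5`, `b = T−5`, from `log (a/b) ≤ a/b − 1`) gives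
`≤ 2.3 log(T+5) + 10`; for `14 < T < 35` the count is at most `N(40) ≤ 32` by the same bound at `t = 40`.
Both are far below the generous registered constant.  Rung currency for the RH-free door `ThetaRadarDoor`;
nothing here bears on the truth of RH.
-/

-- D-0017: `Summit.RiemannHypothesis.RiemannHypothesis.…` duplicates the namespace BY DESIGN (single-problem summit).
set_option linter.dupNamespace false

noncomputable section

namespace Summit.RiemannHypothesis.RiemannHypothesis.Theorems.LittlewoodRadar

open Real
open Literature.NumberTheory.LFunctions
open Literature.NumberTheory.LFunctions.SchoenfeldBound

/-- `log (2π e) ≥ 0` and the main term `M(t) = (t/2π) log (t/(2πe))` splits as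
`(t log t − t log(2πe))/(2π)` for `t > 0`. [folklore] -/
lemma main_eq {t : ℝ} (ht : 0 < t) :
    t / (2 * π) * Real.log (t / (2 * π * Real.exp 1)) =
      (t * Real.log t - t * Real.log (2 * π * Real.exp 1)) / (2 * π) := by
  have hc : 0 < 2 * π * Real.exp 1 := by positivity
  rw [Real.log_div ht.ne' hc.ne']
  field_simp

/-- `log (2π e) ≥ 0`. [folklore] -/
lemma log_two_pi_e_nonneg : 0 ≤ Real.log (2 * π * Real.exp 1) := by
  apply Real.log_nonneg
  have h1 : (1 : ℝ) + 1 ≤ Real.exp 1 := Real.add_one_le_exp 1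
  nlinarith [Real.pi_gt_three]

/-- The main-term increment over a window of length `10`: for `b ≥ 30`, `a = b + 10`,
`M(a) − M(b) ≤ (10 log a + 10) / (2π)`. [folklore] -/
lemma main_sub_main_le {b : ℝ} (hb : 30 ≤ b) :
    (b + 10) / (2 * π) * Real.log ((b + 10) / (2 * π * Real.exp 1)) -
        b / (2 * π) * Real.log (b / (2 * π * Real.exp 1)) ≤
      (10 * Real.log (b + 10) + 10) / (2 * π) := by
  have hb0 : 0 < b := by linarith
  have ha0 : 0 < b + 10 := by linarith
  rw [main_eq ha0, main_eq hb0, ← sub_div, div_le_div_iff_of_pos_right (by positivity)]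
  have hL := log_two_pi_e_nonneg
  -- `b (log a − log b) = b log (a/b) ≤ b (a/b − 1) = 10`
  have hlog : Real.log (b + 10) - Real.log b ≤ 10 / b := by
    rw [← Real.log_div ha0.ne' hb0.ne']
    have := Real.log_le_sub_one_of_pos (show 0 < (b + 10) / b by positivity)
    rw [show (b + 10) / b - 1 = 10 / b by field_simp; ring] at this
    exact this
  have hkey : b * (Real.log (b + 10) - Real.log b) ≤ 10 := by
    calc b * (Real.log (b + 10) - Real.log b) ≤ b * (10 / b) :=
          mul_le_mul_of_nonneg_left hlog hb0.le
      _ = 10 := by field_simp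
  nlinarith

/-- For `T ≥ 35`: `N(T+5) − N(T−5) ≤ 2.3 log(T+5) + 10`. [folklore] -/
lemma count_window_large {T : ℝ} (hT : 35 ≤ T) :
    (zetaZeroCount (T + 5) : ℝ) - zetaZeroCount (T - 5) ≤ 2.3 * Real.log (T + 5) + 10 := by
  have h1 := abs_zetaZeroCount_sub_main_le_explicit (T := T + 5) (by linarith)
  have h2 := abs_zetaZeroCount_sub_main_le_explicit (T := T - 5) (by linarith)
  rw [abs_le] at h1 h2
  have hM := main_sub_main_le (b := T - 5) (by linarith)
  rw [show T - 5 + 10 = T + 5 by ring] at hM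
  have hlogmono : Real.log (T - 5) ≤ Real.log (T + 5) :=
    Real.log_le_log (by linarith) (by linarith)
  have hlog0 : 0 ≤ Real.log (T + 5) := Real.log_nonneg (by linarith)
  have hπ3 := Real.pi_gt_three
  have hfrac : (10 * Real.log (T + 5) + 10) / (2 * π) ≤ (10 * Real.log (T + 5) + 10) / 6 :=
    div_le_div_of_nonneg_left (by positivity) (by norm_num) (by linarith)
  linarith

/-- `N(40) ≤ 32` (crudely, from the explicit bound at `t = 40` with `log x ≤ x − 1`). [folklore] -/
lemma count_forty_le : (zetaZeroCount 40 : ℝ) ≤ 32 := by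
  have h1 := abs_zetaZeroCount_sub_main_le_explicit (T := 40) (by norm_num)
  rw [abs_le] at h1
  have hπ3 := Real.pi_gt_three
  have hπ := Real.pi_pos
  have he : (1 : ℝ) + 1 ≤ Real.exp 1 := Real.add_one_le_exp 1
  have hc : 0 < 2 * π * Real.exp 1 := by positivity
  -- log 40 ≤ 39
  have hl40 : Real.log 40 ≤ 39 := by
    have := Real.log_le_sub_one_of_pos (show (0 : ℝ) < 40 by norm_num); linarith
  -- log (40 / (2π e)) ≤ 40/(2π e) − 1 ≤ 40/12 − 1
  have hq : 40 / (2 * π * Real.exp 1) ≤ 40 / 12 :=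
    div_le_div_of_nonneg_left (by norm_num) (by norm_num) (by nlinarith)
  have hlq : Real.log (40 / (2 * π * Real.exp 1)) ≤ 40 / 12 - 1 := by
    have := Real.log_le_sub_one_of_pos (show (0 : ℝ) < 40 / (2 * π * Real.exp 1) by positivity)
    linarith
  have hcoef : 40 / (2 * π) ≤ 40 / 6 := div_le_div_of_nonneg_left (by norm_num) (by norm_num) (by linarith)
  have hcoef0 : 0 ≤ 40 / (2 * π) := by positivity
  -- main(40) ≤ (40/6) (40/12 − 1); if log(…) < 0 the product is ≤ 0 anyway
  have hmain : 40 / (2 * π) * Real.log (40 / (2 * π * Real.exp 1)) ≤ 40 / 6 * (40 / 12 - 1) := by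
    rcases le_or_gt 0 (Real.log (40 / (2 * π * Real.exp 1))) with h | h
    · calc 40 / (2 * π) * Real.log (40 / (2 * π * Real.exp 1))
          ≤ 40 / 6 * Real.log (40 / (2 * π * Real.exp 1)) := mul_le_mul_of_nonneg_right hcoef h
        _ ≤ 40 / 6 * (40 / 12 - 1) := mul_le_mul_of_nonneg_left hlq (by norm_num)
    · have : 40 / (2 * π) * Real.log (40 / (2 * π * Real.exp 1)) ≤ 0 :=
        mul_nonpos_of_nonneg_of_nonpos hcoef0 h.le
      linarith
  nlinarith

/-- **Registered stub `stub_localcount` of LINE `pintz-kernel`** (crux `PintzLocalisationPos`,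
stmt-RiemannHypothesis-23714): zeros of `ζ` within height `5` of `T > 14`, listed without repetition in
any finite set `Z`, have total multiplicity `≤ 100 (1 + log (T + 5))`. [folklore] -/
theorem stub_localcount :
    ∀ T : ℝ, 14 < T → ∀ Z : Finset ℂ, (∀ ρ ∈ Z, riemannZeta ρ = 0 ∧ |ρ.im - T| < 5) →
      (∑ ρ ∈ Z, ((riemannZetaZeroOrder ρ).toNat : ℝ)) ≤ 100 * (1 + Real.log (T + 5)) := by
  intro T hT Z hZ
  classical
  have h0 : 0 ≤ T - 5 := by linarith
  -- every listed zero lies in the window `(T-5, T+5]` of the closed strip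
  have hsub : Z ⊆ zerosBetween (T - 5) (T + 5) := by
    intro ρ hρ
    obtain ⟨hz, habs⟩ := hZ ρ hρ
    rw [abs_lt] at habs
    have him0 : 0 < ρ.im := by linarith
    rw [mem_zerosBetween h0]
    exact ⟨hz, (Literature.NumberTheory.DiophantineGeometry.re_pos_of_riemannZeta_eq_zero hz him0.ne').le,
      (Literature.NumberTheory.DiophantineGeometry.re_lt_one_of_riemannZeta_eq_zero hz).le,
      by linarith, by linarith⟩
  -- `toNat` is the identity on these (non-negative) orders
  have hcast : ∀ ρ ∈ Z, ((riemannZetaZeroOrder ρ).toNat : ℝ) = (riemannZetaZeroOrder ρ : ℝ) := by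
    intro ρ hρ
    have hnn : (0 : ℝ) ≤ riemannZetaZeroOrder ρ := zeroOrder_nonneg_of_mem_zerosBetween h0 (hsub hρ)
    have hnn' : 0 ≤ riemannZetaZeroOrder ρ := by exact_mod_cast hnn
    have : ((riemannZetaZeroOrder ρ).toNat : ℤ) = riemannZetaZeroOrder ρ := Int.toNat_of_nonneg hnn'
    exact_mod_cast this
  rw [Finset.sum_congr rfl hcast]
  have hle : ∑ ρ ∈ Z, (riemannZetaZeroOrder ρ : ℝ) ≤
      ∑ ρ ∈ zerosBetween (T - 5) (T + 5), (riemannZetaZeroOrder ρ : ℝ) :=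
    Finset.sum_le_sum_of_subset_of_nonneg hsub fun ρ hρ _ ↦ zeroOrder_nonneg_of_mem_zerosBetween h0 hρ
  rw [← zetaZeroCount_sub_eq_sum (by linarith : T - 5 ≤ T + 5)] at hle
  have hlog0 : 0 ≤ Real.log (T + 5) := Real.log_nonneg (by linarith)
  rcases le_or_gt 35 T with hbig | hsmall
  · have := count_window_large hbig
    linarith
  · -- `N(T+5) − N(T−5) ≤ N(40) ≤ 32`
    have hmono : (zetaZeroCount (T + 5) : ℝ) ≤ zetaZeroCount 40 := by
      exact_mod_cast zetaZeroCount_mono (by linarith : T + 5 ≤ 40)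
    have hnn : (0 : ℝ) ≤ zetaZeroCount (T - 5) := Nat.cast_nonneg _
    linarith [count_forty_le]

end Summit.RiemannHypothesis.RiemannHypothesis.Theorems.LittlewoodRadar

end
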